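import Summits.BirchSwinnertonDyer.BirchSwinnertonDyer.Theorems.ManinLocalTwoThreeShimuraIndexSquareBound
import Summits.BirchSwinnertonDyer.BirchSwinnertonDyer.Theorems.ManinLocalTwoThreeShimuraQuotientLevelInstances
import Literature.NumberTheory.EllipticCurves.ManinConstantGamma1Gamma0Comparison
import Literature.NumberTheory.EllipticCurves.EichlerShimuraConstruction
import Mathlib.GroupTheory.Perm.Cycle.Type
import HarnessLib

/-!
# THE `X₀(N)`-CONSTANTS OF STEVENS' CURVE: on the `X₁(N)`-optimal curve `c/c₁` annihilates `Λ₀(f)/Λ₁(f)` —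
# so `exp(Λ₀/Λ₁)·c₁ ∣ c`, `p ∣ [Λ₀ : Λ₁] ⟹ p·c₁ ∣ c`, `[Λ₀ : Λ₁]·c₁² ∣ c²`, and `|c| = |c₁| ⟹ Λ₁(f) = Λ₀(f)`

Summit `BirchSwinnertonDyer`, route `ManinLocalTwoThree` (cell bsd-f2-manin), crux C2 `ManinOddAtFour`
(stmt-BirchSwinnertonDyer-22967; §5 bears equally on C3 `ManinPrimeToThreeAtNine`, stmt-BirchSwinnertonDyer-22968).
Planner seat bsd-f2-manin-es (LENS es: the Shimura covering `X₁(N) → X₀(N)` read on period lattices), gen 46; TURNKEY T-es-114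
for the C2/C3 LEAD (prover bsd-line-manin23-p1).  In-tree imports only; independent of T-es-112/113.

THE SETTING.  One elliptic curve `W/ℚ` (ANY model — no minimality is used) carrying
* an OPTIMAL `X₁(N)`-datum `D₁ : Gamma1ParametrizationData W N`, `D₁.IsOptimal` (`Λ_W = c₁Λ₁(f)`: `W` is STEVENS' curve of its
  class, "`Ker(J₁(N) ↠ E)` connected"; `c₁ = D₁.maninConstant ≠ 0`), and
* ANY `X₀(N)`-datum `D : ModularParametrizationData W N` of the same curve (`cΛ₀(f) ⊆ Λ_W`, `c = D.maninConstant`).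
The two data share their newform (`IsNewformOf.unique`) and their Néron lattice (`IsNeronLatticeOf.lattice_eq`) — both PROVED in
the tree — so `cΛ₀(f) ⊆ Λ_W = c₁Λ₁(f) ⊆ c₁Λ₀(f)`.

THE OBSERVATION (§2–§3).  `c₁ ∣ c` (`(c/c₁)ω₁ ∈ Λ_W` and `PeriodPair.mul_ω₁_add_mul_ω₂_mem_lattice`; the tree's
`Gamma1ParametrizationData.IsOptimal.maninConstant_dvd_maninConstant` is the two-curve version under global minimality — here one
curve, any model, three lines), and THE INTEGER `t = c/c₁` MULTIPLIES `Λ₀(f)` INTO `Λ₁(f)`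
(`maninConstant_div_mul_mem_periodLatticeGamma1_sameCurve`).  Hence every bound of the cell's Shimura-index files applies to `t`:
* §4 `exp(Λ₀(f)/Λ₁(f)) · c₁ ∣ c` (`exponent_mul_maninConstant₁_dvd_maninConstant_sameCurve`);
* §4 `[Λ₀(f) : Λ₁(f)] · c₁² ∣ c²` (T-es-111 `relIndex_dvd_natAbs_sq_of_intMul_mem`);
* §5 `p` prime, `p ∣ [Λ₀(f) : Λ₁(f)]` ⟹ `p · c₁ ∣ c` (Cauchy in the finite quotient; `prime_mul_maninConstant₁_dvd_maninConstant_sameCurve`);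
  at `4 ∣ N`: `Λ₁ ≠ Λ₀ ⟹ 2c₁ ∣ c`; at `9 ∣ N`: `Λ₁ ≠ Λ₀ ⟹ 3c₁ ∣ c`;
* §6 `|c| = |c₁|` (in particular `|c| = 1`) ⟹ **`Λ₁(f) = Λ₀(f)`**; contrapositively `Λ₁(f) ≠ Λ₀(f) ⟹ |c| ≥ 2|c₁|`:
  «a curve that is `X₁(N)`-optimal AND carries an `X₀(N)`-parametrisation with the same constant has trivial Shimura quotient»;
* §7 DOUBLY OPTIMAL curves (`W` also `X₀(N)`-LATTICE-optimal, `Λ_W = cΛ₀(f)`, i.e. `E₀ = E₁`): `c ∣ m·c₁` whenever `mΛ₀ ⊆ Λ₁`, so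
  `Λ₁(f) = Λ₀(f) ⟺ |c| = |c₁|`, and at `4 ∣ N`: `Λ₁(f) ≠ Λ₀(f) ⟺ |c| = 2|c₁|` (at `9 ∣ N`: `⟺ |c| = 3|c₁|`).

READING FOR THE CELL (desc §65 «LAW [Λ₀(f) : Λ₁(f)] = max of Cremona's `X₀`-Manin constants over the class», es E15).  The minimal
`X₀(N)`-constant of Stevens' curve `E₁` is a multiple of `|c₁|·exp(Λ₀/Λ₁)` and of `|c₁|·p` for every prime `p ∣ [Λ₀ : Λ₁]` (§4–§5) —
with `|c₁| = 1` (Stevens; in the tree for `N ≤ 5·10⁵` modulo ČNS Lemma 6.5) this is the LOWER half of that law (`11a3 = E₁` of `11a`: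
`5 ∣ c` for every `X₀(11)`-datum of `11a3`, the least being `z ↦ 5z : ℂ/Λ₀ → ℂ/Λ₁`; `17a`/`15a`: `[Λ₀ : Λ₁] = 4` cyclic, `4 ∣ c(E₁)`;
non-optimal curves with constant `> 1`: Agashe–Ribet–Stein §2).  And §6 with `|c₀| = |c₁| = 1` (Cremona / Stevens, every
class of the census): **`[Λ₀(f) : Λ₁(f)] ≠ 1 ⟹ E₁ ≠ E₀`** — the 99 E15 classes with index `> 1` (73 × 2, 23 × 3, 15a/17a × 4, 11a × 5)
all have a Stevens curve different from the optimal curve, by a THEOREM of the tree rather than by table look-up; in the other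
direction nothing is claimed (`E₁ ≠ E₀` with `Λ₁ = Λ₀` is not excluded here).

HONEST FRAMING.  Elementary lattice bookkeeping (Stevens 1989 §2; ČNS 2024 Lemma 6.5 / §1 fn. 2 «every parametrisation factors through
the optimal one»), new in the tree in the `relIndex` currency of T-es-107…113; no Néron models, no minimality, no facts consumed.
C2, C3, Manin's conjecture and BSD are NOT proved by this file.  No definitions, no sorry.
[cite: Stevens1989, §2 and Thm. 1.6] [cite: CesnaviciusNeururerSaha2023, Lemma 6.5 and §1 fn. 2] [cite: Manin1972, Thm. 1.6]
[cite: LingOesterle1991, Thm. 6] [cite: Cremona1997, §2.10 and Table] [cite: AgasheRibetStein2006, §2] [cite: SilvermanAEC2009, Thm. VI.5.1]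
-/

set_option autoImplicit false
-- the summit-side namespace `Summit.BirchSwinnertonDyer.BirchSwinnertonDyer.…` is the tree's (summit = sub-problem)
set_option linter.dupNamespace false

noncomputable section

open scoped Classical MatrixGroups

open CongruenceSubgroup Matrix.SpecialLinearGroup ModularGroup
open Literature.NumberTheory.EllipticCurves Literature.NumberTheory.EllipticCurves.ModularForms

namespace Summit.BirchSwinnertonDyer.BirchSwinnertonDyer.Theorems.ManinLocalTwoThree.ShimuraIndex

section StevensCurve

variable {W : WeierstrassCurve ℚ} {N : ℕ} [NeZero N]

/-! ## §1 Two lemmas: integrality on a period lattice, and integer ↦ natural multipliers -/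

omit [NeZero N] in
/-- **`(a/b)·ω₁ ∈ Λ` forces `b ∣ a`** (`Λ = ℤω₁ ⊕ ℤω₂`; Mathlib `PeriodPair.mul_ω₁_add_mul_ω₂_mem_lattice`). [folklore] -/
theorem int_dvd_of_div_mul_ω₁_mem (L : PeriodPair) {a b : ℤ} (hb : b ≠ 0)
    (h : ((a : ℂ) / (b : ℂ)) * L.ω₁ ∈ L.lattice) : b ∣ a := by
  have e : ((a : ℂ) / (b : ℂ)) * L.ω₁ = ((((a : ℚ) / (b : ℚ) : ℚ)) : ℂ) * L.ω₁ + ((0 : ℚ) : ℂ) * L.ω₂ := by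
    push_cast; ring
  rw [e] at h
  have hden := (PeriodPair.mul_ω₁_add_mul_ω₂_mem_lattice (L := L) (α := (a : ℚ) / (b : ℚ)) (β := 0)).mp h
  exact (Rat.den_div_intCast_eq_one_iff a b hb).mp hden.1

omit [NeZero N] in
/-- `tz ∈ Λ₁(f)` with `t : ℤ` ⟹ `|t|z ∈ Λ₁(f)`. [folklore] -/
theorem natAbs_mul_mem_periodLatticeGamma1_of_intMul_mem (f : CuspForm (Gamma0 N) 2) {t : ℤ} {z : ℂ}
    (h : (t : ℂ) * z ∈ periodLatticeGamma1 f) : (t.natAbs : ℂ) * z ∈ periodLatticeGamma1 f := by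
  rcases Int.natAbs_eq t with h' | h'
  · rw [h'] at h
    simpa only [Int.cast_natCast] using h
  · rw [h'] at h
    simp only [Int.cast_neg, Int.cast_natCast, neg_mul] at h
    exact neg_mem_iff.mp h

omit [NeZero N] in
/-- `Λ₁(f) ≠ Λ₀(f)` ⟹ `[Λ₀(f) : Λ₁(f)] ≠ 1`. [folklore] -/
theorem relIndex_ne_one_of_ne {f : CuspForm (Gamma0 N) 2} (hne : periodLatticeGamma1 f ≠ periodLattice f) :
    (periodLatticeGamma1 f).relIndex (periodLattice f) ≠ 1 := fun h ↦
  hne (le_antisymm (periodLatticeGamma1_le_periodLattice f) (AddSubgroup.relIndex_eq_one.mp h))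

/-! ## §2 One curve, two data: same newform, same lattice, `c₁ ∣ c` -/

/-- An `X₁(N)`-datum and an `X₀(N)`-datum of ONE curve have the same newform (`q`-expansions, `IsNewformOf.unique`).
[cite: Knapp1993, Thm. 11.67] -/
theorem f_eq_of_sameCurve (D₁ : Gamma1ParametrizationData W N) (D : ModularParametrizationData W N) : D.f = D₁.f :=
  D.isNewformOf.unique D₁.isNewformOf

/-- … and the same Néron lattice (all Néron-type period pairs of a model span one lattice, `IsNeronLatticeOf.lattice_eq`).
[cite: SilvermanAEC2009, Thm. VI.5.1 (uniqueness)] -/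
theorem lattice_eq_of_sameCurve (D₁ : Gamma1ParametrizationData W N) (D : ModularParametrizationData W N) :
    D.L.lattice = D₁.L.lattice :=
  D.isNeronLattice.lattice_eq D₁.isNeronLattice

/-- **`c₁ ∣ c` on Stevens' curve (any model).**  For the optimal `X₁(N)`-datum `D₁` (`Λ_W = c₁Λ₁(f)`) and any `X₀(N)`-datum `D`
of the same curve: `ω₁ = c₁w₁` with `w₁ ∈ Λ₁(f) ⊆ Λ₀(f)`, `cw₁ ∈ Λ_W`, so `(c/c₁)ω₁ ∈ Λ_W` and `c₁ ∣ c`.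
(Two-curve version under global minimality: `Gamma1ParametrizationData.IsOptimal.maninConstant_dvd_maninConstant`, ČNS Lemma 6.5.)
[cite: CesnaviciusNeururerSaha2023, Lemma 6.5 and §1 fn. 2] [cite: Stevens1989, §2] -/
theorem maninConstant₁_dvd_maninConstant_sameCurve (D₁ : Gamma1ParametrizationData W N) (h₁ : D₁.IsOptimal)
    (D : ModularParametrizationData W N) : D₁.maninConstant ∣ D.maninConstant := by
  have hf := f_eq_of_sameCurve D₁ D
  have hL := lattice_eq_of_sameCurve D₁ D
  obtain ⟨w, hw, hω⟩ := h₁ D₁.L.ω₁ D₁.L.ω₁_mem_lattice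
  have hw₀ : w ∈ periodLattice D.f := by
    rw [hf]; exact periodLatticeGamma1_le_periodLattice D₁.f hw
  have hmem : (D.c : ℂ) * w ∈ D₁.L.lattice := by
    rw [← hL]; exact D.smul_periodLattice_le w hw₀
  have hb : (D₁.c : ℂ) ≠ 0 := by exact_mod_cast D₁.maninConstant_ne_zero
  have e : (D.c : ℂ) * w = ((D.c : ℂ) / (D₁.c : ℂ)) * D₁.L.ω₁ := by
    rw [hω, div_mul_eq_mul_div, eq_div_iff hb]; ring
  rw [e] at hmem
  exact int_dvd_of_div_mul_ω₁_mem D₁.L D₁.maninConstant_ne_zero hmem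

/-- `c = c₁ · (c/c₁)` (exact division). [cite: CesnaviciusNeururerSaha2023, Lemma 6.5] -/
theorem maninConstant_eq_mul_div_sameCurve (D₁ : Gamma1ParametrizationData W N) (h₁ : D₁.IsOptimal)
    (D : ModularParametrizationData W N) :
    D.maninConstant = D₁.maninConstant * (D.maninConstant / D₁.maninConstant) :=
  (Int.mul_ediv_cancel' (maninConstant₁_dvd_maninConstant_sameCurve D₁ h₁ D)).symm

/-! ## §3 The quotient `t = c/c₁` multiplies `Λ₀(f)` into `Λ₁(f)` -/

/-- **`(c/c₁)·Λ₀(f) ⊆ Λ₁(f)` on Stevens' curve.**  For `z ∈ Λ₀(f)`: `cz ∈ Λ_W = c₁Λ₁(f)`, `cz = c₁w`, `w ∈ Λ₁(f)`; cancel `c₁`.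
So the integer `c/c₁` annihilates the Shimura quotient `Λ₀(f)/Λ₁(f)`. [cite: Stevens1989, §2] [cite: LingOesterle1991, Thm. 6] -/
theorem maninConstant_div_mul_mem_periodLatticeGamma1_sameCurve (D₁ : Gamma1ParametrizationData W N)
    (h₁ : D₁.IsOptimal) (D : ModularParametrizationData W N) :
    ∀ z ∈ periodLattice D.f, ((D.maninConstant / D₁.maninConstant : ℤ) : ℂ) * z ∈ periodLatticeGamma1 D.f := by
  intro z hz
  set t : ℤ := D.maninConstant / D₁.maninConstant with ht_def
  have ht : D.maninConstant = D₁.maninConstant * t := maninConstant_eq_mul_div_sameCurve D₁ h₁ D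
  have hf := f_eq_of_sameCurve D₁ D
  have hL := lattice_eq_of_sameCurve D₁ D
  have hmem : (D.c : ℂ) * z ∈ D₁.L.lattice := by
    rw [← hL]; exact D.smul_periodLattice_le z hz
  obtain ⟨w, hw, e⟩ := h₁ _ hmem
  have hb : (D₁.c : ℂ) ≠ 0 := by exact_mod_cast D₁.maninConstant_ne_zero
  have ht' : (D.c : ℂ) = (D₁.c : ℂ) * (t : ℂ) := by
    change D.c = D₁.c * t at ht
    exact_mod_cast ht
  have hw' : (t : ℂ) * z = w := by
    have h2 : (D₁.c : ℂ) * ((t : ℂ) * z) = (D₁.c : ℂ) * w := by rw [← mul_assoc, ← ht', e]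
    exact mul_left_cancel₀ hb h2
  rw [hw', hf]
  exact hw

/-! ## §4 The exponent and the square bound: `exp(Λ₀/Λ₁)·c₁ ∣ c`, `[Λ₀ : Λ₁]·c₁² ∣ c²` -/

/-- **`exp(Λ₀(f)/Λ₁(f)) · c₁ ∣ c`**: the exponent of the (finite) Shimura quotient divides every integer annihilating it, in
particular `|c/c₁|` (§3).  With `|c₁| = 1` (Stevens): the exponent divides EVERY `X₀(N)`-constant of Stevens' curve.
[cite: Stevens1989, §2] [cite: LingOesterle1991, Thm. 6] -/
theorem exponent_mul_maninConstant₁_dvd_maninConstant_sameCurve (D₁ : Gamma1ParametrizationData W N)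
    (h₁ : D₁.IsOptimal) (D : ModularParametrizationData W N) :
    (AddMonoid.exponent (periodLattice D.f ⧸ (periodLatticeGamma1 D.f).addSubgroupOf (periodLattice D.f)) : ℤ)
      * D₁.maninConstant ∣ D.maninConstant := by
  set t : ℤ := D.maninConstant / D₁.maninConstant with ht_def
  have ht : D.maninConstant = D₁.maninConstant * t := maninConstant_eq_mul_div_sameCurve D₁ h₁ D
  set H : AddSubgroup (periodLattice D.f) := (periodLatticeGamma1 D.f).addSubgroupOf (periodLattice D.f) with hH
  have hexp : AddMonoid.exponent (periodLattice D.f ⧸ H) ∣ t.natAbs := by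
    refine AddMonoid.exponent_dvd_of_forall_nsmul_eq_zero fun q ↦ ?_
    obtain ⟨x, rfl⟩ := QuotientAddGroup.mk_surjective q
    rw [← QuotientAddGroup.mk_nsmul, QuotientAddGroup.eq_zero_iff, hH, AddSubgroup.mem_addSubgroupOf]
    show (t.natAbs • x : periodLattice D.f).val ∈ periodLatticeGamma1 D.f
    simp only [AddSubgroupClass.coe_nsmul, nsmul_eq_mul]
    exact natAbs_mul_mem_periodLatticeGamma1_of_intMul_mem D.f
      (maninConstant_div_mul_mem_periodLatticeGamma1_sameCurve D₁ h₁ D _ x.2)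
  have hexpZ : (AddMonoid.exponent (periodLattice D.f ⧸ H) : ℤ) ∣ t := Int.natCast_dvd.mpr hexp
  rw [ht, mul_comm (AddMonoid.exponent (periodLattice D.f ⧸ H) : ℤ)]
  exact mul_dvd_mul_left _ hexpZ

/-- **`[Λ₀(f) : Λ₁(f)] · c₁² ∣ c²`** (T-es-111's square bound `mΛ₀ ⊆ Λ₁ ⟹ [Λ₀ : Λ₁] ∣ m²` at `m = c/c₁`).
[cite: LingOesterle1991, Thm. 6] [cite: Stevens1989, §2] -/
theorem relIndex_mul_maninConstant₁_sq_dvd_maninConstant_sq_sameCurve (D₁ : Gamma1ParametrizationData W N)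
    (h₁ : D₁.IsOptimal) (D : ModularParametrizationData W N) :
    ((periodLatticeGamma1 D.f).relIndex (periodLattice D.f) : ℤ) * D₁.maninConstant ^ 2 ∣ D.maninConstant ^ 2 := by
  set t : ℤ := D.maninConstant / D₁.maninConstant with ht_def
  have ht : D.maninConstant = D₁.maninConstant * t := maninConstant_eq_mul_div_sameCurve D₁ h₁ D
  have hsq : (periodLatticeGamma1 D.f).relIndex (periodLattice D.f) ∣ t.natAbs ^ 2 :=
    relIndex_dvd_natAbs_sq_of_intMul_mem D (maninConstant_div_mul_mem_periodLatticeGamma1_sameCurve D₁ h₁ D)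
  have hsqZ : ((periodLatticeGamma1 D.f).relIndex (periodLattice D.f) : ℤ) ∣ t ^ 2 := by
    have h := Int.natCast_dvd_natCast.mpr hsq
    rwa [Nat.cast_pow, Int.natCast_natAbs, sq_abs] at h
  rw [ht, mul_pow, mul_comm ((periodLatticeGamma1 D.f).relIndex (periodLattice D.f) : ℤ)]
  exact mul_dvd_mul_left _ hsqZ

/-! ## §5 Prime divisors of the index: `p ∣ [Λ₀ : Λ₁] ⟹ p·c₁ ∣ c`; the cell's primes `2` (`4 ∣ N`) and `3` (`9 ∣ N`) -/

/-- **`p ∣ [Λ₀(f) : Λ₁(f)]` ⟹ `p · c₁ ∣ c`** for every prime `p` and every `X₀(N)`-datum of Stevens' curve: the quotient is finite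
(`relIndex_ne_zero`, T-es-108), so it has an element of order `p` (Cauchy), whence `p ∣ exp(Λ₀/Λ₁) ∣ c/c₁` (§4).
(`11a`: `E₁ = 11a3`, `5 ∣ c` for every `X₀(11)`-datum of `11a3`, least `5`; `15a`, `17a`: `2 ∣ c(E₁)`, in fact `4 ∣` by §4 as the
quotient is cyclic.) [cite: AgasheRibetStein2006, §2] [cite: Stevens1989, §2] [cite: LingOesterle1991, Thm. 6] -/
theorem prime_mul_maninConstant₁_dvd_maninConstant_sameCurve (D₁ : Gamma1ParametrizationData W N)
    (h₁ : D₁.IsOptimal) (D : ModularParametrizationData W N) {p : ℕ} (hp : p.Prime)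
    (hpi : p ∣ (periodLatticeGamma1 D.f).relIndex (periodLattice D.f)) :
    (p : ℤ) * D₁.maninConstant ∣ D.maninConstant := by
  set H : AddSubgroup (periodLattice D.f) := (periodLatticeGamma1 D.f).addSubgroupOf (periodLattice D.f) with hH
  have hidx : H.index ≠ 0 := by
    have h := relIndex_ne_zero D.f
    rwa [AddSubgroup.relIndex] at h
  haveI : Fintype (periodLattice D.f ⧸ H) := AddSubgroup.fintypeOfIndexNeZero hidx
  haveI := Fact.mk hp
  have hcard : p ∣ Fintype.card (periodLattice D.f ⧸ H) := by
    rwa [AddSubgroup.relIndex, AddSubgroup.index_eq_card, Nat.card_eq_fintype_card] at hpi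
  obtain ⟨x, hx⟩ := exists_prime_addOrderOf_dvd_card p hcard
  have hpe : p ∣ AddMonoid.exponent (periodLattice D.f ⧸ H) := hx ▸ AddMonoid.addOrder_dvd_exponent x
  exact (mul_dvd_mul_right (Int.natCast_dvd_natCast.mpr hpe) _).trans
    (exponent_mul_maninConstant₁_dvd_maninConstant_sameCurve D₁ h₁ D)

/-- **At `4 ∣ N`: `Λ₁(f) ≠ Λ₀(f)` ⟹ `2c₁ ∣ c`** (`[Λ₀ : Λ₁] ∣ 4`, T-es-111 `relIndex_dvd_four_of_four_dvd`, so `≠ 1` means even).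
The C2 reading: an `X₀(N)`-constant of Stevens' curve is EVEN at every `4 ∣ N` level with non-trivial Shimura quotient (with
`|c₁| = 1`). [cite: LingOesterle1991, Thm. 6] [cite: Stevens1989, §2] -/
theorem two_mul_maninConstant₁_dvd_of_four_dvd_of_ne_sameCurve (D₁ : Gamma1ParametrizationData W N)
    (h₁ : D₁.IsOptimal) (D : ModularParametrizationData W N) (h4 : 2 ^ 2 ∣ N)
    (hne : periodLatticeGamma1 D.f ≠ periodLattice D.f) : (2 : ℤ) * D₁.maninConstant ∣ D.maninConstant := by
  have h4' : (periodLatticeGamma1 D.f).relIndex (periodLattice D.f) ∣ 2 ^ 2 :=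
    relIndex_dvd_sq_of_natMul_mem D fun z hz ↦ by
      exact_mod_cast two_mul_mem_periodLatticeGamma1_of_four_dvd D h4 hz
  obtain ⟨k, hk, hke⟩ := (Nat.dvd_prime_pow Nat.prime_two).mp h4'
  have hk0 : k ≠ 0 := by
    rintro rfl
    exact relIndex_ne_one_of_ne hne (by rw [hke, pow_zero])
  have h2 : 2 ∣ (periodLatticeGamma1 D.f).relIndex (periodLattice D.f) := by
    rw [hke]; exact dvd_pow_self 2 hk0
  exact_mod_cast prime_mul_maninConstant₁_dvd_maninConstant_sameCurve D₁ h₁ D Nat.prime_two h2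

/-- **At `9 ∣ N`: `Λ₁(f) ≠ Λ₀(f)` ⟹ `3c₁ ∣ c`** (`[Λ₀ : Λ₁] ∣ 9`, T-es-111 `relIndex_dvd_nine_of_nine_dvd`).  The C3 reading.
[cite: LingOesterle1991, Thm. 6] [cite: Stevens1989, §2] -/
theorem three_mul_maninConstant₁_dvd_of_nine_dvd_of_ne_sameCurve (D₁ : Gamma1ParametrizationData W N)
    (h₁ : D₁.IsOptimal) (D : ModularParametrizationData W N) (h9 : 3 ^ 2 ∣ N)
    (hne : periodLatticeGamma1 D.f ≠ periodLattice D.f) : (3 : ℤ) * D₁.maninConstant ∣ D.maninConstant := by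
  have h9' : (periodLatticeGamma1 D.f).relIndex (periodLattice D.f) ∣ 3 ^ 2 :=
    relIndex_dvd_sq_of_natMul_mem D fun z hz ↦ by
      exact_mod_cast three_mul_mem_periodLatticeGamma1_of_nine_dvd D h9 hz
  obtain ⟨k, hk, hke⟩ := (Nat.dvd_prime_pow Nat.prime_three).mp h9'
  have hk0 : k ≠ 0 := by
    rintro rfl
    exact relIndex_ne_one_of_ne hne (by rw [hke, pow_zero])
  have h3 : 3 ∣ (periodLatticeGamma1 D.f).relIndex (periodLattice D.f) := by
    rw [hke]; exact dvd_pow_self 3 hk0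
  exact_mod_cast prime_mul_maninConstant₁_dvd_maninConstant_sameCurve D₁ h₁ D Nat.prime_three h3

/-! ## §6 The equality case: `|c| = |c₁| ⟹ Λ₁(f) = Λ₀(f)`; `Λ₁ ≠ Λ₀ ⟹ |c| ≥ 2|c₁|` -/

/-- **`|c| = |c₁|` ⟹ `Λ₁(f) = Λ₀(f)`**: then `c/c₁ = ±1` multiplies `Λ₀(f)` into `Λ₁(f)` (§3).  «A curve which is `X₁(N)`-optimal and
carries an `X₀(N)`-parametrisation with the same constant has trivial Shimura quotient.» [cite: Stevens1989, §2] [cite: LingOesterle1991, Thm. 6] -/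
theorem periodLatticeGamma1_eq_of_natAbs_maninConstant_eq_sameCurve (D₁ : Gamma1ParametrizationData W N)
    (h₁ : D₁.IsOptimal) (D : ModularParametrizationData W N)
    (h : D.maninConstant.natAbs = D₁.maninConstant.natAbs) : periodLatticeGamma1 D.f = periodLattice D.f := by
  refine le_antisymm (periodLatticeGamma1_le_periodLattice _) fun z hz ↦ ?_
  have hmem := maninConstant_div_mul_mem_periodLatticeGamma1_sameCurve D₁ h₁ D z hz
  have hb0 : D₁.maninConstant ≠ 0 := D₁.maninConstant_ne_zero
  rcases Int.natAbs_eq_natAbs_iff.mp h with h' | h'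
  · rw [h', Int.ediv_self hb0, Int.cast_one, one_mul] at hmem
    exact hmem
  · rw [h', Int.neg_ediv_of_dvd (dvd_refl _), Int.ediv_self hb0, Int.cast_neg, Int.cast_one, neg_one_mul] at hmem
    exact neg_mem_iff.mp hmem

/-- **`|c| = 1` ⟹ `Λ₁(f) = Λ₀(f)`** on Stevens' curve (`c₁ ∣ c` forces `|c₁| = 1 = |c|`).  With Cremona's `|c₀| = 1` for the
optimal curve (tree: `cremona_abs_maninConstant_eq_one_of_level_le_500000`, a fact binder): `E₀ = E₁ ⟹ Λ₁(f) = Λ₀(f)`, i.e.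
**`[Λ₀(f) : Λ₁(f)] ≠ 1 ⟹ E₁ ≠ E₀`** — the 99 E15 classes with index `> 1`. [cite: Cremona1997, §2.10 and Table] [cite: Stevens1989, §2] -/
theorem periodLatticeGamma1_eq_of_natAbs_maninConstant_eq_one_sameCurve (D₁ : Gamma1ParametrizationData W N)
    (h₁ : D₁.IsOptimal) (D : ModularParametrizationData W N) (hc : D.maninConstant.natAbs = 1) :
    periodLatticeGamma1 D.f = periodLattice D.f := by
  apply periodLatticeGamma1_eq_of_natAbs_maninConstant_eq_sameCurve D₁ h₁ D
  have hd := Int.natAbs_dvd_natAbs.mpr (maninConstant₁_dvd_maninConstant_sameCurve D₁ h₁ D)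
  rw [hc] at hd ⊢
  exact (Nat.dvd_one.mp hd).symm

/-- **`Λ₁(f) ≠ Λ₀(f)` ⟹ `2|c₁| ≤ |c|`** for every `X₀(N)`-datum of Stevens' curve (some prime `p ∣ [Λ₀ : Λ₁] ≠ 1` gives `p·c₁ ∣ c ≠ 0`).
[cite: Stevens1989, §2] [cite: LingOesterle1991, Thm. 6] -/
theorem two_mul_natAbs_le_of_periodLatticeGamma1_ne_sameCurve (D₁ : Gamma1ParametrizationData W N)
    (h₁ : D₁.IsOptimal) (D : ModularParametrizationData W N) (hne : periodLatticeGamma1 D.f ≠ periodLattice D.f) :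
    2 * D₁.maninConstant.natAbs ≤ D.maninConstant.natAbs := by
  obtain ⟨p, hp, hpi⟩ := Nat.exists_prime_and_dvd (relIndex_ne_one_of_ne hne)
  have hd := Int.natAbs_dvd_natAbs.mpr (prime_mul_maninConstant₁_dvd_maninConstant_sameCurve D₁ h₁ D hp hpi)
  rw [Int.natAbs_mul, Int.natAbs_natCast] at hd
  have hpos : 0 < D.maninConstant.natAbs := Int.natAbs_pos.mpr D.maninConstant_ne_zero_holds
  exact (Nat.mul_le_mul_right _ hp.two_le).trans (Nat.le_of_dvd hpos hd)

/-! ## §7 Doubly optimal curves (`E₀ = E₁`): `c ∣ m·c₁` for `mΛ₀ ⊆ Λ₁`; `Λ₁ = Λ₀ ⟺ |c| = |c₁|`; at `4 ∣ N`: `Λ₁ ≠ Λ₀ ⟺ |c| = 2|c₁|` -/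

/-- **On a curve that is also `X₀(N)`-LATTICE-optimal (`Λ_W = cΛ₀(f)`): `mΛ₀(f) ⊆ Λ₁(f)` ⟹ `c ∣ m·c₁`** (`ω₁ = cw`, `mw ∈ Λ₁`,
`c₁mw ∈ Λ_W`, so `(mc₁/c)ω₁ ∈ Λ_W`).  With §4: on a doubly optimal curve `|c/c₁| = exp(Λ₀(f)/Λ₁(f))`.
[cite: Manin1972, Thm. 1.6] [cite: Stevens1989, §2] [cite: LingOesterle1991, Thm. 6] -/
theorem maninConstant_dvd_mul_maninConstant₁_of_latticeOptimal_sameCurve (D₁ : Gamma1ParametrizationData W N)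
    (D : ModularParametrizationData W N) (hopt : ∀ z ∈ D.L.lattice, ∃ w ∈ periodLattice D.f, z = D.c * w) {m : ℕ}
    (hm : ∀ z ∈ periodLattice D.f, (m : ℂ) * z ∈ periodLatticeGamma1 D.f) :
    D.maninConstant ∣ (m : ℤ) * D₁.maninConstant := by
  have hf := f_eq_of_sameCurve D₁ D
  have hL := lattice_eq_of_sameCurve D₁ D
  obtain ⟨w, hw, hω⟩ := hopt D.L.ω₁ D.L.ω₁_mem_lattice
  have hmw : (m : ℂ) * w ∈ periodLatticeGamma1 D₁.f := hf ▸ hm w hw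
  have hmem : (D₁.c : ℂ) * ((m : ℂ) * w) ∈ D.L.lattice := by
    rw [hL]; exact D₁.smul_periodLatticeGamma1_le _ hmw
  have hc : (D.c : ℂ) ≠ 0 := by exact_mod_cast D.maninConstant_ne_zero_holds
  have e : (D₁.c : ℂ) * ((m : ℂ) * w) = ((((m : ℤ) * D₁.c : ℤ) : ℂ) / (D.c : ℂ)) * D.L.ω₁ := by
    rw [hω, div_mul_eq_mul_div, eq_div_iff hc]; push_cast; ring
  rw [e] at hmem
  exact int_dvd_of_div_mul_ω₁_mem D.L D.maninConstant_ne_zero_holds hmem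

/-- **Doubly optimal: `Λ₁(f) = Λ₀(f) ⟺ |c| = |c₁|`** (⟸ §6; ⟹ `c ∣ 1·c₁` from the previous theorem and `c₁ ∣ c`).
[cite: Stevens1989, §2] [cite: Manin1972, Thm. 1.6] -/
theorem periodLatticeGamma1_eq_iff_natAbs_eq_of_latticeOptimal_sameCurve (D₁ : Gamma1ParametrizationData W N)
    (h₁ : D₁.IsOptimal) (D : ModularParametrizationData W N)
    (hopt : ∀ z ∈ D.L.lattice, ∃ w ∈ periodLattice D.f, z = D.c * w) :
    periodLatticeGamma1 D.f = periodLattice D.f ↔ D.maninConstant.natAbs = D₁.maninConstant.natAbs := by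
  refine ⟨fun heq ↦ ?_, periodLatticeGamma1_eq_of_natAbs_maninConstant_eq_sameCurve D₁ h₁ D⟩
  have h1 : D.maninConstant ∣ (((1 : ℕ) : ℤ)) * D₁.maninConstant :=
    maninConstant_dvd_mul_maninConstant₁_of_latticeOptimal_sameCurve D₁ D hopt fun z hz ↦ by
      rw [Nat.cast_one, one_mul, heq]; exact hz
  rw [Nat.cast_one, one_mul] at h1
  exact Nat.dvd_antisymm (Int.natAbs_dvd_natAbs.mpr h1)
    (Int.natAbs_dvd_natAbs.mpr (maninConstant₁_dvd_maninConstant_sameCurve D₁ h₁ D))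

/-- **Doubly optimal at `4 ∣ N`: `Λ₁(f) ≠ Λ₀(f) ⟺ |c| = 2|c₁|`** (`c ∣ 2c₁` as `2Λ₀ ⊆ Λ₁`; `2c₁ ∣ c` when `Λ₁ ≠ Λ₀`, §5).  So if the
`X₀(N)`-optimal curve of a class with `4 ∣ N` is also its `X₁(N)`-optimal curve, the Shimura quotient is read off the two constants.
[cite: LingOesterle1991, Thm. 6] [cite: Stevens1989, §2] [cite: CesnaviciusNeururerSaha2023, Lemma 6.5] -/
theorem periodLatticeGamma1_ne_iff_natAbs_eq_two_mul_of_four_dvd_sameCurve (D₁ : Gamma1ParametrizationData W N)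
    (h₁ : D₁.IsOptimal) (D : ModularParametrizationData W N)
    (hopt : ∀ z ∈ D.L.lattice, ∃ w ∈ periodLattice D.f, z = D.c * w) (h4 : 2 ^ 2 ∣ N) :
    periodLatticeGamma1 D.f ≠ periodLattice D.f ↔ D.maninConstant.natAbs = 2 * D₁.maninConstant.natAbs := by
  have hc₁ : D₁.maninConstant.natAbs ≠ 0 := Int.natAbs_ne_zero.mpr D₁.maninConstant_ne_zero
  constructor
  · intro hne
    have hup : D.maninConstant ∣ ((2 : ℕ) : ℤ) * D₁.maninConstant :=
      maninConstant_dvd_mul_maninConstant₁_of_latticeOptimal_sameCurve D₁ D hopt fun z hz ↦ by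
        exact_mod_cast two_mul_mem_periodLatticeGamma1_of_four_dvd D h4 hz
    have hdown := two_mul_maninConstant₁_dvd_of_four_dvd_of_ne_sameCurve D₁ h₁ D h4 hne
    have h1 := Int.natAbs_dvd_natAbs.mpr hup
    have h2 := Int.natAbs_dvd_natAbs.mpr hdown
    rw [Int.natAbs_mul, Int.natAbs_natCast] at h1
    rw [Int.natAbs_mul] at h2
    change 2 * D₁.maninConstant.natAbs ∣ D.maninConstant.natAbs at h2
    exact Nat.dvd_antisymm h1 h2
  · intro h heq
    have h' := (periodLatticeGamma1_eq_iff_natAbs_eq_of_latticeOptimal_sameCurve D₁ h₁ D hopt).mp heq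
    omega

/-- **Doubly optimal at `9 ∣ N`: `Λ₁(f) ≠ Λ₀(f) ⟺ |c| = 3|c₁|`.** [cite: LingOesterle1991, Thm. 6] [cite: Stevens1989, §2] -/
theorem periodLatticeGamma1_ne_iff_natAbs_eq_three_mul_of_nine_dvd_sameCurve (D₁ : Gamma1ParametrizationData W N)
    (h₁ : D₁.IsOptimal) (D : ModularParametrizationData W N)
    (hopt : ∀ z ∈ D.L.lattice, ∃ w ∈ periodLattice D.f, z = D.c * w) (h9 : 3 ^ 2 ∣ N) :
    periodLatticeGamma1 D.f ≠ periodLattice D.f ↔ D.maninConstant.natAbs = 3 * D₁.maninConstant.natAbs := by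
  have hc₁ : D₁.maninConstant.natAbs ≠ 0 := Int.natAbs_ne_zero.mpr D₁.maninConstant_ne_zero
  constructor
  · intro hne
    have hup : D.maninConstant ∣ ((3 : ℕ) : ℤ) * D₁.maninConstant :=
      maninConstant_dvd_mul_maninConstant₁_of_latticeOptimal_sameCurve D₁ D hopt fun z hz ↦ by
        exact_mod_cast three_mul_mem_periodLatticeGamma1_of_nine_dvd D h9 hz
    have hdown := three_mul_maninConstant₁_dvd_of_nine_dvd_of_ne_sameCurve D₁ h₁ D h9 hne
    have h1 := Int.natAbs_dvd_natAbs.mpr hup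
    have h2 := Int.natAbs_dvd_natAbs.mpr hdown
    rw [Int.natAbs_mul, Int.natAbs_natCast] at h1
    rw [Int.natAbs_mul] at h2
    change 3 * D₁.maninConstant.natAbs ∣ D.maninConstant.natAbs at h2
    exact Nat.dvd_antisymm h1 h2
  · intro h heq
    have h' := (periodLatticeGamma1_eq_iff_natAbs_eq_of_latticeOptimal_sameCurve D₁ h₁ D hopt).mp heq
    omega

end StevensCurve

end Summit.BirchSwinnertonDyer.BirchSwinnertonDyer.Theorems.ManinLocalTwoThree.ShimuraIndex
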